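import Literature.Barriers.CriticalPhenomena.LaceExpansionEtaZeroXSpaceAt
import Literature.Barriers.CriticalPhenomena.LaceExpansionXSpaceTwoLongLinesReduction
import Literature.Barriers.CriticalPhenomena.GaussianDominationRouteBootstrapHolds
import Literature.Barriers.CriticalPhenomena.KozmaNachmiasLemma51
import Literature.Barriers.CriticalPhenomena.LaceExpansionHighDimensionOneArmUnconditional
import HarnessLib

/-!
# `η = 0` in `x`-space, the two-point bounded ratio and Kozma–Nachmias's `ρ_ex = 1/2`
# for ALL SUFFICIENTLY LARGE `d` — UNCONDITIONAL kernel theorems (pure assembly)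

Barrier catalogue `Literature/Barriers/CriticalPhenomena/` (D-0021). THEOREMS ONLY (no definition,
no named fact, nothing taken as a hypothesis): this file joins four proved developments of the
catalogue that had not been combined —

* `HvdH2017_prop88_holds` (`GaussianDominationRouteBootstrapHolds.lean`): the successful bootstrap
  of Heydenreich–van der Hofstad, Prop. 8.8 (Hara–Slade 1990), a theorem of the tree;
* `exists_etaZeroXSpace_largeD_of_twoLongLinesAt` (`LaceExpansionEtaZeroXSpaceAt.lean`): Hara's
  `x`-space reduction (Hara 2008, §1.2: Prop. 1.2 at `p_c`, the Gaussian lemma Cor. 1.4, Lemmas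
  1.5–1.7, Appendix A — all proved) for all large `d`, from `HvdH2017_prop88` and the body of the
  two-long-lines estimate (§3.5) for all large `d`;
* `twoLongLines_real` (`LaceExpansionXSpaceTwoLongLinesReduction.lean`): Hara's two-long-lines
  estimate §3.5 at `p_c`, PROVED for every `d ≥ 1` with `S̄_{p_c} < ∞` and `2Δ̃_{p_c}Δ̄_{p_c} < 1`;
* `exists_isLaceCoefficientPc_largeD_of_prop88`, `two_mul_percTriTildeBar_mul_percTriBar_lt_one_of_prop88`
  (`LaceExpansionPcSubcritLargeDHolds.lean`, `LaceExpansionPcTriangleLargeD.lean`): Prop. 1.2 at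
  `p_c` with a finite second moment, and the geometric rate `2Δ̃_{p_c}Δ̄_{p_c} < 1`, for all large
  `d`, from `HvdH2017_prop88`; with Lemma 1.7 (`Hara2008_lemma17Pc_holds`) the former gives
  `S̄_{p_c} < ∞`.

Consequently (main results, namespace `Literature.Barriers.CriticalPhenomena`):

* `twoLongLinesAt_eventually` — the body of `Hara2008_twoLongLinesDiagramBoundPc` for all large `d`,
  unconditionally;
* **`etaZeroXSpace_eventually : ∃ d₀, ∀ d ≥ d₀, EtaZeroXSpace d`** — Hara 2008, Thm. 1.1 in its
  printed LARGE-`d` form ("for the nearest-neighbor model with `d ≥ 19` … [complete] for large `d`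
  (say `d ≥ 30`)", §1.2), here `∃ d₀` with the (un-optimised) threshold of the formal proof:
  `τ_{p_c}(x) = A₂|x|^{2-d}(1 + O(|x|^{-2/d}))` — with NO named fact left;
* **`twoPointBoundedRatio_eventually : ∃ d₀, 6 < d₀ ∧ ∀ d ≥ d₀, TwoPointBoundedRatio d`** —
  Aizenman's (t-c) with `η = 0` (Heydenreich–van der Hofstad (1.2.3)/(1.2.14)) for all large `d`
  (`EtaZeroXSpace.twoPointBoundedRatio`, `tau_criticalProbI_pos`);
* **`rhoExHalf_eventually : ∃ d₀, 6 < d₀ ∧ ∀ d ≥ d₀, RhoExHalf d`** — Kozma–Nachmias 2011, Thm. 1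
  (`c/n² ≤ P_{p_c}(0 ↔ ∂Λ_n) ≤ C/n²`, Heydenreich–van der Hofstad Thm. 11.5 (11.3.2)) for all
  sufficiently large `d`, UNCONDITIONALLY: `TwoPointBoundedRatio.rhoExHalf` (`KozmaNachmiasLemma51.lean`,
  the whole of Kozma–Nachmias's paper proved from the two-point estimate) composed with the above;
  `oneArm_le_div_sq_eventually` — the upper half alone, in the shape consumed by the summit files.

STATUS OF THE THRESHOLD. `d₀` is existential here because the `x`-space chain of the catalogue
packages its thresholds existentially at each layer (cf. `LaceExpansionHighDimensionMeanFieldExplicit.lean`,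
which makes the `k`-space chain explicit, `D_HS ≈ 1.37·10⁴⁹`); it is a property of the formal proof,
not an estimate of the true range of the method (Hara 2008: `d ≥ 19`; with Fitzner–van der Hofstad's
numerics `d ≥ 11`, vendored as `Hara2008_etaZeroXSpace` / `KozmaNachmias2011_rhoExHalf`, which remain
named facts for `11 ≤ d < d₀`). Honest reading: REPRODUCTION of published theorems (Hara–Slade 1990,
Hara 2008, Kozma–Nachmias 2011); the novelty is the machine-checked, hypothesis-free statement.

## References

* T. Hara, *Decay of correlations in nearest-neighbor self-avoiding walk, percolation, lattice
  trees and animals*, Ann. Probab. 36 (2008) 530–593: Thm. 1.1, §1.2, Prop. 1.2, Lemmas 1.5–1.7,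
  §3.5. [Hara2008]
* T. Hara, G. Slade, *Mean-field critical behaviour for percolation in high dimensions*,
  Comm. Math. Phys. 128 (1990) 333–391: Thm. 1.1. [HaraSlade1990]
* G. Kozma, A. Nachmias, *Arm exponents in high dimensional percolation*, J. Amer. Math. Soc. 24
  (2011) 375–409: Thm. 1. [KozmaNachmias2011]
* M. Heydenreich, R. van der Hofstad, *Progress in High-Dimensional Percolation and Random Graphs*,
  Springer 2017: (1.2.3)–(1.2.4), (1.2.14), Prop. 8.8, Thm. 11.4, Thm. 11.5. [HeydenreichVanDerHofstad2017]
* M. Aizenman, *On the number of incipient spanning clusters*, Nucl. Phys. B 485 (1997) 551–582: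
  §5 (condition (t-c)). [Aizenman1997]
-/

noncomputable section

open scoped ENNReal

namespace Literature.Barriers.CriticalPhenomena

open _root_.MeasureTheory Literature.Probability.LatticeModels Literature.Probability.Percolation

/-- **`S̄_{p_c} < ∞` from Prop. 1.2 at `p_c` (one `d ≥ 11`)**: a lace-expansion coefficient `Φ`
at `p_c` with `Σ_x |x|²|Φ(x)| < ∞` gives `S̄^{(0)}_{p_c} < ∞` by Lemma 1.7
(`Hara2008_lemma17Pc_holds`, clause `S̄^{(γ)}` at `γ = 0 ≤ ⌊2⌋`, `0 < d - 8`), and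
`S̄_{p_c} = S̄^{(0)}_{p_c}` (`percSqBar_eq_haraSBar_zero`). The step is that of
`Hara2008_twoLongLinesDiagramBoundPc_of_leafInputs`, isolated. [cite: Hara2008, Lemma 1.7 and Prop. 1.2] -/
theorem percSqBar_lt_top_of_coefficient {d : ℕ} (hd11 : 11 ≤ d) {Φ : Site d → ℝ}
    (hΦ : IsLaceCoefficientPc d Φ) (hsum : Summable fun x : Site d => euclidNorm x ^ 2 * |Φ x|) :
    percSqBar d < ⊤ := by
  rw [percSqBar_eq_haraSBar_zero]
  have hsum' : Summable fun x : Site d => euclidNorm x ^ (2 : ℝ) * |Φ x| := by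
    have h : (fun x : Site d => euclidNorm x ^ (2 : ℝ) * |Φ x|) = fun x => euclidNorm x ^ 2 * |Φ x| := by
      funext x; rw [Real.rpow_two]
    rw [h]; exact hsum
  have h17 := Hara2008_lemma17Pc_holds d hd11 Φ hΦ 2 le_rfl hsum'
  have hd8 : (0 : ℝ) < (d : ℝ) - 8 := by
    have : (11 : ℝ) ≤ d := by exact_mod_cast hd11
    linarith
  exact h17.2.2.2.1 0 le_rfl not_isOddInt_zero
    (by exact_mod_cast Int.floor_nonneg.2 (by norm_num : (0 : ℝ) ≤ 2)) hd8

/-- **The two-long-lines estimate (Hara 2008, §3.5) at `p_c` for ALL SUFFICIENTLY LARGE `d`,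
unconditionally** — the body of the named fact `Hara2008_twoLongLinesDiagramBoundPc` at every
`d ≥ d₁`: `twoLongLines_real` with `S̄_{p_c} < ∞` from Prop. 1.2 at `p_c`
(`exists_isLaceCoefficientPc_largeD_of_prop88`, Lemma 1.7) and `κ = 2Δ̃_{p_c}Δ̄_{p_c} < 1`
(`two_mul_percTriTildeBar_mul_percTriBar_lt_one_of_prop88`), both from the tree's theorem
`HvdH2017_prop88_holds`. [cite: Hara2008, §3.5 and Lemma 1.5]
[cite: HeydenreichVanDerHofstad2017, Prop. 8.8 and Cor. 8.13] -/
theorem twoLongLinesAt_eventually :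
    ∃ d₁ : ℕ, ∀ d : ℕ, d₁ ≤ d → ∃ C q : ℝ, 0 < q ∧ q < 1 ∧
      ∀ (N : ℕ), 1 ≤ N → ∀ (x : Site d) (b : ℝ), x ≠ 0 →
        (∀ y : Site d, euclidNorm x / (2 * N + 1) - 1 ≤ euclidNorm y →
          tau d (criticalProbI d) 0 y ≤ b) →
        piNDiagramPc d N x ≤ ENNReal.ofReal (C * ((N : ℝ) + 1) ^ 2 * q ^ N * b ^ 2) := by
  obtain ⟨dP, hP⟩ := exists_isLaceCoefficientPc_largeD_of_prop88 HvdH2017_prop88_holds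
  obtain ⟨dK, hK⟩ := two_mul_percTriTildeBar_mul_percTriBar_lt_one_of_prop88 HvdH2017_prop88_holds
  refine ⟨max (max dP dK) 11, fun d hd => ?_⟩
  have hdP : dP ≤ d := le_trans (le_max_left _ _) (le_trans (le_max_left _ _) hd)
  have hdK : dK ≤ d := le_trans (le_max_right _ _) (le_trans (le_max_left _ _) hd)
  have hd11 : 11 ≤ d := le_trans (le_max_right _ _) hd
  have hκ1 : kap d < 1 := hK d hdK
  obtain ⟨Φ, hΦ, hsum⟩ := hP d hdP
  exact twoLongLines_real (le_trans (by norm_num) hd11) (percSqBar_lt_top_of_coefficient hd11 hΦ hsum) hκ1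

/-- **Hara 2008, Thm. 1.1 (large-`d` form), UNCONDITIONAL in the kernel:
`∃ d₀, ∀ d ≥ d₀, EtaZeroXSpace d`**, i.e. for every sufficiently large `d` there are `A₂ > 0`, `K`,
`R` with `|τ_{p_c}(0,x) - A₂|x|^{2-d}| ≤ K|x|^{2-d}|x|^{-2/d}` for `|x| ≥ R` (Heydenreich–van der
Hofstad, Thm. 11.4 (11.2.3), "`η = 0` in `x`-space"). Assembly: `exists_etaZeroXSpace_largeD_of_twoLongLinesAt`
(Hara's framework §1.2, the Gaussian lemma, Lemmas 1.5–1.7 — proved in the catalogue) applied to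
`HvdH2017_prop88_holds` and `twoLongLinesAt_eventually`. The threshold is that of the formal proof
(existential, un-optimised), not Hara's `19`.
[cite: Hara2008, Thm. 1.1 and §1.2] [cite: HeydenreichVanDerHofstad2017, Thm. 11.4 (11.2.3)]
[cite: HaraSlade1990, Thm. 1.1] -/
theorem etaZeroXSpace_eventually : ∃ d₀ : ℕ, ∀ d : ℕ, d₀ ≤ d → EtaZeroXSpace d :=
  exists_etaZeroXSpace_largeD_of_twoLongLinesAt HvdH2017_prop88_holds twoLongLinesAt_eventually

/-- **Aizenman's (t-c) with `η = 0` for all sufficiently large `d`, UNCONDITIONAL: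
`∃ d₀ > 6, ∀ d ≥ d₀, TwoPointBoundedRatio d`** — `c'‖x-y‖^{2-d} ≤ τ_{p_c}(x,y) ≤ C‖x-y‖^{2-d}`
(`x ≠ y`), from `etaZeroXSpace_eventually` by `EtaZeroXSpace.twoPointBoundedRatio` (the asymptotic
sense refines the bounded-ratio sense, Heydenreich–van der Hofstad p. 16) and `τ_{p_c} > 0`
(`tau_criticalProbI_pos`). [cite: HeydenreichVanDerHofstad2017, (1.2.3)–(1.2.4) and (1.2.14)]
[cite: Aizenman1997, §5 (condition (t-c) with η = 0)] [cite: Hara2008, Thm. 1.1] -/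
theorem twoPointBoundedRatio_eventually :
    ∃ d₀ : ℕ, 6 < d₀ ∧ ∀ d : ℕ, d₀ ≤ d → TwoPointBoundedRatio d := by
  obtain ⟨d₀, h⟩ := etaZeroXSpace_eventually
  refine ⟨max d₀ 7, lt_of_lt_of_le (by norm_num) (le_max_right _ _), fun d hd => ?_⟩
  have hd₀ : d₀ ≤ d := le_trans (le_max_left _ _) hd
  have hd7 : 7 ≤ d := le_trans (le_max_right _ _) hd
  exact (h d hd₀).twoPointBoundedRatio (by omega) fun x => tau_criticalProbI_pos (by omega) 0 x

/-- **Kozma–Nachmias 2011, Thm. 1 for all sufficiently large `d`, UNCONDITIONAL in the kernel: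
`∃ d₀ > 6, ∀ d ≥ d₀, RhoExHalf d`**, i.e. `c/n² ≤ P_{p_c}(0 ↔ ∂Λ_n) ≤ C/n²` for all `n ≥ 1`
(Heydenreich–van der Hofstad, Thm. 11.5 (11.3.2), "`ρ_ex = 1/2`"). The whole of Kozma–Nachmias's
paper is proved in the catalogue from the two-point estimate (`TwoPointBoundedRatio.rhoExHalf`,
`KozmaNachmiasLemma51.lean`: Lemma 1.1, Thm. 4, Chapter 5, Thm. 2, Lemma 2.3, the §2 induction), and
the two-point estimate is `twoPointBoundedRatio_eventually` (Hara–Slade 1990 + Hara 2008, proved).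
Printed range: `d ≥ 19` (Kozma–Nachmias, via Hara), `d ≥ 11` (Fitzner–van der Hofstad 2017); here
`d ≥ d₀` with the formal proof's existential threshold.
[cite: KozmaNachmias2011, Thm. 1] [cite: HeydenreichVanDerHofstad2017, Thm. 11.5 (11.3.2)]
[cite: Hara2008, Thm. 1.1] -/
theorem rhoExHalf_eventually : ∃ d₀ : ℕ, 6 < d₀ ∧ ∀ d : ℕ, d₀ ≤ d → RhoExHalf d := by
  obtain ⟨d₀, h6, h⟩ := twoPointBoundedRatio_eventually
  exact ⟨d₀, h6, fun d hd => (h d hd).rhoExHalf (lt_of_lt_of_le h6 hd)⟩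

/-- **The mean-field one-arm upper bound for all sufficiently large `d`, UNCONDITIONAL** (the
upper half of `rhoExHalf_eventually`, in the shape `∃ C, ∀ n ≥ 1, P_{p_c}(0 ↔ ∂Λ_n) ≤ C/n²`):
Kozma–Nachmias 2011, Thm. 1 (upper bound). [cite: KozmaNachmias2011, Thm. 1]
[cite: HeydenreichVanDerHofstad2017, Thm. 11.5 (11.3.2)] -/
theorem oneArm_le_div_sq_eventually :
    ∃ d₀ : ℕ, 6 < d₀ ∧ ∀ d : ℕ, d₀ ≤ d →
      ∃ C : ℝ, ∀ n : ℕ, 1 ≤ n → oneArmProb d (criticalProbI d) n ≤ C / (n : ℝ) ^ 2 := by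
  obtain ⟨d₀, h6, h⟩ := rhoExHalf_eventually
  refine ⟨d₀, h6, fun d hd => ?_⟩
  obtain ⟨c, C, -, hcC⟩ := h d hd
  exact ⟨C, fun n hn => (hcC n hn).2⟩

/-- **Consistency check of the catalogue's barrier with its positive result**: the eventual
threshold is at least `6` for a reason — `RhoExHalf d` forces `6 ≤ d` (`RhoExHalf.six_le`, the
Dewan–Muirhead / Aizenman–Barsky hyperscaling obstruction, unconditional), so no assembly of this
kind can ever lower `d₀` below `6`. [cite: DewanMuirhead2022, §1.1 and Thm. 1.1]
[cite: KozmaNachmias2011, Thm. 1] -/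
theorem six_le_of_rhoExHalf_threshold {d₀ : ℕ} (h : ∀ d : ℕ, d₀ ≤ d → RhoExHalf d) : 6 ≤ d₀ := by
  by_contra hlt
  have h5 : RhoExHalf (max d₀ 2) := h _ (le_max_left _ _)
  have h2 : 2 ≤ max d₀ 2 := le_max_right _ _
  have hle5 : max d₀ 2 ≤ 5 := max_le (by omega) (by norm_num)
  exact not_rhoExHalf_of_le_five h2 hle5 h5

end Literature.Barriers.CriticalPhenomena

end
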